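import Summits.QuantumFields.YangMills.Theorems.BalabanUVNodesN16OfLeafTPHolder
import Summits.QuantumFields.YangMills.Theorems.BalabanUVNodesN16OfLeafTP
import Literature.MathematicalPhysics.QuantumFieldTheory.Balaban1983to89.B8LeafModelZd3H
import HarnessLib

/-!
# Route «BalabanUVNodes» (K3⁗ `SpineGivenEndpointR13Sep`), DAG node N16 = NE3 — THE N05 → N16 EDGE RE-HOMED AT n05-c's REPAIRED FAMILY `B8LeafModelZd3H.zdGF3H`
# (p504278: `zdGF3` with the source space read as in print — Lie-algebra valued, supported in Ω₀, finite |·|₍₋₂₎ — every other field `rfl`-equal):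
# Theorem 4 ∕ Proposition 3 as typed there, and node N05's leaf-of-record SHAPE `B8LeafKnitRS.B8LeafRS` there, ⟹ N16's root

Cell `pub-ymgap`, seat `pub-ymgap-dag-n16-c` (R134 fan-out seat, strategy s1; HUMAN RULING D-0062; chair R424 venue), generation 5, file 43 — over files 40 ∕ 41
(`N16OfLeafTP`, `N16OfLeafTPHolder`: the Thm 4 ∕ Prop 3 re-cut at `zdGF3`) and n05-c's `B8LeafModelZd3H` (the additive repair ρ1 of the Theorem-8 source-space typing
that made the SHAPE uninhabited at `zdGF3`, p501857 ∕ p503878).  `--supports stmt-QuantumFields-20292 --as helper` (K3⁗, dag-lead WORDS-140).  `bears_on: R4∕N16 · edge N05 → N16`.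

WHY.  The six «leaf of record SHAPE» ★s of this lineage live at `zdGF3`, where the SHAPE is uninhabited (file 40 §1).  n05-c's repair is ADDITIVE: the family of record
moves to `zdGF3H 𝔸 L β len i := { zdGF3 … with InR := InR138 … f ∧ (∀ x, IsSelfAdjoint (f x)) ∧ (∀ x ∉ Ω₀, f x = 0) ∧ Bdd … f }`, whose `toGFData` ∕ `toGFData2` parts —
everything [Balaban1985RegularSpaces] Theorem 4 (p. 88) and Proposition 3 (p. 87) read — are `zdGF3`'s by `rfl` (`zdGF3H_toGFData`, `zdGF3H_toGFData2`).  Hence (§1) the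
Thm 4 ∕ Prop 3 tops of file 40 hold at `zdGF3H` VERBATIM (term-mode `exact`, definitional unfolding), and (§2) the ★ statements «N16 from node N05's leaf-of-record SHAPE»
are RE-HOMED at `zdGF3H`, where the SHAPE is NOT known to be uninhabited (n05-c's two certified holes are closed there by construction:
`B8LeafModelZd3H.not_inR_zdGF3H_of_not_isSelfAdjoint`, `not_inR_zdGF3H_of_not_bdd`), by reading the SHAPE's `t4` ∕ `p3` fields into §1 ∕ file 41.

WHAT THIS FILE PROVES (kernel, theorems only, 0 `def`, 0 sorry): §1 `n16_of_leafTPH` (β = 1), `n16_holderMS_of_leafTPH_l1Len` (R-β″) — file 40's tops at `zdGF3H`;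
§2 ★ `n16_of_b8LeafRSH` (β = 1: the SHAPE at `zdGF3H … L 1 len` + letters + N07's (H3ˢᵘᵖ) ⟹ `NE3EnergyRateWCov`, generation 0's ★ p465074 re-homed), ★
`n16_holderMS_of_b8LeafRSH_l1Len` (any `β ∈ [0,1]`: the SHAPE at `zdGF3H … L β l1Len` ⟹ `CovRootHolderMS … β`, generation 4's ★ p500931 re-homed), ★ `ne3Shape_of_b8LeafRSH_holder`
(any β: the SHAPE ⟹ the YM-PLAN row decl `T4EtaRateMin.NE3Shape` at the minimal-action readings; generation 3's ★ p486929 re-homed), `leafSlot_of_b8LeafRSH`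
(n16-e's record slot `N16LeafSlot.LeafSlot c` from the SHAPE at `zdGF3H … c.L 1 len`; n16-e's `N16LeafSlotRS.leafSlot_of_b8LeafRS` re-homed), `leafSlotHolderMS_of_b8LeafRSH` (n16-e's MS leaf β-slot
`N16HolderMSLeafSlot.LeafSlotHolderMS c β` — the entry of n16-e's MS record kit — from the SHAPE at `zdGF3H … c.L β len`; `leafSlotHolderMS_of_b8LeafRS` re-homed).
HONEST FRAMING: bookkeeping by name (definitional transfers); nothing of Bałaban is proved here; Theorem 4 ∕ Proposition 3 ∕ the SHAPE at `zdGF3H` are node N05's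
theorems-to-be (Thm 4 ∕ Prop 3 in the tree only modulo n05-a's sockets — `B8LeafModelZd3H.thm4Printed_zd3H` ∕ `prop3Printed_zd3H`; the SHAPE's `t8` at `zdGF3H` is
n05-c's `B8Thm8SurvivingZd3H` modulo sourced sockets, `p5e ∕ p5u ∕ p6 ∕ p7` named hypotheses of N05's knits), (H3ˢᵘᵖ) = N07's [Balaban1985Variational] Thm 1 TYPE;
N16 ∕ NE3 NOT discharged; count-neutral; one finite four-torus at fixed ε — NOT ℝ⁴, NOT infinite volume, NOT OS, NOT a mass gap, NOT Clay.
-/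

set_option autoImplicit false

open scoped BigOperators Matrix Matrix.Norms.L2Operator
open NormedSpace

namespace Summit.QuantumFields.YangMills.BalabanUVNodes.N16OfLeafH

open Literature.MathematicalPhysics.QuantumFieldTheory.Balaban1983to89
open B7Prop1Explicit B7Prop2Explicit
open B7Prop3Flat (c3)
open T4AveragingDeficitWall (fineAction blockSites)
open T4AveragingDeficitWallBoundary (periodBox)
open T4EtaRateMin (NE3Shape)
open B8LeafModelZd (ZdIdx)
open B8LeafModelZd3 (zdGF3)
open B8LeafModelZd3H (zdGF3H)
open B8LeafKnitRS (B8LeafRS)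
open Summit.QuantumFields.BalabanUV.T4Continuum
open BlockAverageCurrent (curConst)
open NE3EnergyWeightedCovShape (NE3EnergyRateWCov)
open NE3RightInverseSupLetters (frameC)
open NE3.LeafIndexSockets (LeafH3sup)
open MinimalActionSandwich (IsMinimiser)
open MinimalActionRate (sfClass minActReadings)
open MinimalActionRefine (RegularSup)
open YMDAG.UVSplit (NE3Carriers)
open Summit.QuantumFields.YangMills.BalabanUVNodes.N16HolderMSDefs (CovRootHolderMS)
open Summit.QuantumFields.YangMills.BalabanUVNodes.N16LeafSlot (LeafSlot)
open Summit.QuantumFields.YangMills.BalabanUVNodes.N16HolderMSLeafSlot (LeafSlotHolderMS)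
open Summit.QuantumFields.YangMills.BalabanUVNodes.N16OfLeafTP (n16_of_leafTP n16_holderMS_of_leafTP_l1Len)
open Summit.QuantumFields.YangMills.BalabanUVNodes.N16OfLeafTPHolder (leafSlot_of_leafTP leafSlotHolderMS_of_leafTP ne3Shape_of_leafTP_holder)
open B9Eq340HolderZd (l1Len)

noncomputable section

/-! ## §1 Theorem 4 ∕ Proposition 3 as typed AT `zdGF3H` ⟹ N16's root (file 40's tops, definitional transfer) -/

section Matrices

variable {n : Type} [Fintype n] [DecidableEq n]

/-- **N16 · NE3 (β = 1) FROM NODE N05's THEOREM 4 AND PROPOSITION 3 ON `zdGF3H (M_n(ℂ)) L 1 len` OVER THE UNIV SUB-INDEX, AND N07's (H3ˢᵘᵖ)** (`d = 4`, `L ≥ 2`, `N ≥ 1`)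
— file 40's `N16OfLeafTP.n16_of_leafTP` with `zdGF3 ↦ zdGF3H`; the same term proves it (`(zdGF3H …).toGFData`, `.toGFData2` are `zdGF3`'s by `rfl`, n05-c's
`zdGF3H_toGFData` ∕ `zdGF3H_toGFData2`).  N16 ∕ NE3 NOT proved: Theorem 4 ∕ Proposition 3 there are node N05's theorems, (H3ˢᵘᵖ) is N07's.
[cite: Balaban1985RegularSpaces, Thm 4 p.88, Prop. 3 p.87] [folklore] -/
theorem n16_of_leafTPH [Nonempty n] {L N : ℕ} (hL : 2 ≤ L) (hN : 1 ≤ N) :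
    letI : CStarAlgebra (Matrix n n ℂ) := {}
    ∃ r : ℝ, 0 < r ∧ ∀ ⦃g : ℝ⦄, 0 < g → ∃ C : ℝ, 0 ≤ C ∧
      ∀ (C₂ B₁' : ℝ) (inp : B8.B9Inputs) (B₀β : ℝ) (len : Site 4 → ℝ),
      (∀ v : Site 4, 0 < len v → 1 ≤ len v) → (∀ μ : Fin 4, len (e μ) = 1) → 0 < B₁' → 5 * ((4 : ℕ) : ℝ) * L * inp.B₀ ≤ B₁' →
      B8.Thm4Printed B₁' (fun i : {i : ZdIdx 4 L // i.Ω 0 = Set.univ} => (zdGF3H (Matrix n n ℂ) L 1 len i.1).toGFData) →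
      B8.Prop3Printed 4 (L : ℝ) C₂ inp B₀β
        (fun i : {i : ZdIdx 4 L // i.Ω 0 = Set.univ} => (zdGF3H (Matrix n n ℂ) L 1 len i.1).toGFData2) →
      ∃ c₁' : ℝ, 0 < c₁' ∧ 16 * (5 * ((4 : ℕ) : ℝ) * L * inp.B₀ * c₁') ≤ 1 ∧
      ∀ ⦃b' c' : ℝ⦄, 0 ≤ b' → 0 ≤ c' →
      2 ^ 15 * ((4 : ℝ) + 1) ^ 2 * ((4 : ℝ) + 4) ^ 2 * (L : ℝ) ^ 2 * b' ≤ 1 →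
      23040 * (4 : ℝ) ^ 4 * (frameC 4 L + 4) ^ 3 * (c' + curConst 4 L * b' ^ 2) ≤ 1 →
      ∀ ⦃α : ℝ⦄, 0 < α → C0 4 * α ≤ 1 / 3 → 2 * α ≤ c2' 4 L → 11 * (4 : ℝ) ^ 2 * α ≤ 1 / 6 → α + 11 * (4 : ℝ) ^ 2 * α ≤ c₁' →
      b' + 226 * (8 * ((4 : ℝ) + 1) * ((4 : ℝ) + 4)) ^ 2 * b' ^ 2 < α → 4 * ((4 : ℝ) - 1) * (c' + curConst 4 L * b' ^ 2) < α →
      ∀ ⦃Mc : ℝ⦄, 0 ≤ Mc → (Mc + 1) * (b' + 226 * (8 * ((4 : ℝ) + 1) * ((4 : ℝ) + 4)) ^ 2 * b' ^ 2) ≤ 1 / 2 →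
      ∀ (𝒬 : ℕ → Set (Set (Site 4) × ℕ)), (∀ k, ∀ q ∈ 𝒬 k, q.2 ≤ k ∧ ∃ y : Site 4, ∀ z ∈ q.1, (l1 (z - y) : ℝ) ≤ Mc * (L : ℝ) ^ q.2) →
      ∀ ⦃C335 : ℝ⦄, 2 * (Mc + 1) * (b' + 226 * (8 * ((4 : ℝ) + 1) * ((4 : ℝ) + 4)) ^ 2 * b' ^ 2) + 2 * Mc * (2 * (c' + curConst 4 L * b' ^ 2)) +
        4 * Mc * (1 + 2 * Mc) * (b' + 226 * (8 * ((4 : ℝ) + 1) * ((4 : ℝ) + 4)) ^ 2 * b' ^ 2) ^ 2 < C335 →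
      ∀ ⦃ε s₁ b s₂ : ℝ⦄, 0 < ε → ε ≤ r → ε < α → 0 ≤ s₁ → s₁ ≤ r → 0 ≤ b → b ≤ ε / 2 →
      5 * ((4 : ℕ) : ℝ) * L * inp.B₀ * (α + 11 * (4 : ℝ) ^ 2 * α) ≤ s₁ →
      5 * ((4 : ℕ) : ℝ) * L * inp.B₀ * (α + 11 * (4 : ℝ) ^ 2 * α) +
          2 * (b' + 226 * (8 * ((4 : ℝ) + 1) * ((4 : ℝ) + 4)) ^ 2 * b' ^ 2) * s₁ ≤ s₁ →
      5 * ((4 : ℕ) : ℝ) * L * inp.B₀ * (α + 11 * (4 : ℝ) ^ 2 * α) + 16 * (b' + 226 * (8 * ((4 : ℝ) + 1) * ((4 : ℝ) + 4)) ^ 2 * b' ^ 2) *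
          (5 * ((4 : ℕ) : ℝ) * L * inp.B₀ * (α + 11 * (4 : ℝ) ^ 2 * α)) ≤ s₁ →
      5 * ((4 : ℕ) : ℝ) * L * B₀β * (α + 11 * (4 : ℝ) ^ 2 * α) + 8 * (b' + 226 * (8 * ((4 : ℝ) + 1) * ((4 : ℝ) + 4)) ^ 2 * b' ^ 2) *
          (5 * ((4 : ℕ) : ℝ) * L * inp.B₀ * (α + 11 * (4 : ℝ) ^ 2 * α)) ≤ s₂ →
      ∀ {dom : _root_.Set (Site 4 → Fin 4 → (Matrix n n ℂ)ˣ)},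
        LeafH3sup 4 L N ε b' c' dom →
        NE3EnergyRateWCov 4 (sfClass 4 L N ε) L N b g C s₁ s₂ dom :=
  n16_of_leafTP (n := n) hL hN

/-- **N16 · THE MULTI-SCALE β-ROOT FROM NODE N05's THEOREM 4 AND PROPOSITION 3 ON `zdGF3H (M_n(ℂ)) L β l1Len` OVER THE UNIV SUB-INDEX, AND N07's (H3ˢᵘᵖ)**
(`d = 4`, `L ≥ 2`, `N ≥ 1`, any `β ∈ [0,1]`; print's ℓ¹ length) — file 40's ★ `N16OfLeafTP.n16_holderMS_of_leafTP_l1Len` with `zdGF3 ↦ zdGF3H`; the same term proves it.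
N16 ∕ NE3 NOT proved: Theorem 4 ∕ Proposition 3 there are node N05's theorems, (H3ˢᵘᵖ) is N07's.
[cite: Balaban1985RegularSpaces, Thm 4 p.88, Prop. 3 p.87, (1.36) p.82; Balaban1985BackgroundPropagators, (3.40) p.397] [folklore] -/
theorem n16_holderMS_of_leafTPH_l1Len [Nonempty n] {L N : ℕ} (hL : 2 ≤ L) (hN : 1 ≤ N) :
    letI : CStarAlgebra (Matrix n n ℂ) := {}
    ∃ r : ℝ, 0 < r ∧ ∀ ⦃g : ℝ⦄, 0 < g → ∃ C : ℝ, 0 ≤ C ∧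
      ∀ ⦃β : ℝ⦄, 0 ≤ β → β ≤ 1 → ∀ (C₂ B₁' : ℝ) (inp : B8.B9Inputs) (B₀β : ℝ),
      0 < B₁' → 5 * ((4 : ℕ) : ℝ) * L * inp.B₀ ≤ B₁' →
      B8.Thm4Printed B₁' (fun i : {i : ZdIdx 4 L // i.Ω 0 = Set.univ} => (zdGF3H (Matrix n n ℂ) L β l1Len i.1).toGFData) →
      B8.Prop3Printed 4 (L : ℝ) C₂ inp B₀β
        (fun i : {i : ZdIdx 4 L // i.Ω 0 = Set.univ} => (zdGF3H (Matrix n n ℂ) L β l1Len i.1).toGFData2) →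
      ∃ c₁' : ℝ, 0 < c₁' ∧ 16 * (5 * ((4 : ℕ) : ℝ) * L * inp.B₀ * c₁') ≤ 1 ∧
      ∀ ⦃b' c' : ℝ⦄, 0 ≤ b' → 0 ≤ c' →
      2 ^ 15 * ((4 : ℝ) + 1) ^ 2 * ((4 : ℝ) + 4) ^ 2 * (L : ℝ) ^ 2 * b' ≤ 1 →
      23040 * (4 : ℝ) ^ 4 * (frameC 4 L + 4) ^ 3 * (c' + curConst 4 L * b' ^ 2) ≤ 1 →
      ∀ ⦃α : ℝ⦄, 0 < α → C0 4 * α ≤ 1 / 3 → 2 * α ≤ c2' 4 L → 11 * (4 : ℝ) ^ 2 * α ≤ 1 / 6 → α + 11 * (4 : ℝ) ^ 2 * α ≤ c₁' →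
      b' + 226 * (8 * ((4 : ℝ) + 1) * ((4 : ℝ) + 4)) ^ 2 * b' ^ 2 < α → 4 * ((4 : ℝ) - 1) * (c' + curConst 4 L * b' ^ 2) < α →
      ∀ ⦃Mc : ℝ⦄, 0 ≤ Mc → (Mc + 1) * (b' + 226 * (8 * ((4 : ℝ) + 1) * ((4 : ℝ) + 4)) ^ 2 * b' ^ 2) ≤ 1 / 2 →
      ∀ (𝒬 : ℕ → Set (Set (Site 4) × ℕ)), (∀ k, ∀ q ∈ 𝒬 k, q.2 ≤ k ∧ ∃ y : Site 4, ∀ z ∈ q.1, (l1 (z - y) : ℝ) ≤ Mc * (L : ℝ) ^ q.2) →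
      ∀ ⦃C335 : ℝ⦄, 2 * (Mc + 1) * (b' + 226 * (8 * ((4 : ℝ) + 1) * ((4 : ℝ) + 4)) ^ 2 * b' ^ 2) + 2 * Mc * (2 * (c' + curConst 4 L * b' ^ 2)) +
        4 * Mc * (1 + 2 * Mc) * (b' + 226 * (8 * ((4 : ℝ) + 1) * ((4 : ℝ) + 4)) ^ 2 * b' ^ 2) ^ 2 < C335 →
      ∀ ⦃ε s₁ b s₂ : ℝ⦄, 0 < ε → ε ≤ r → ε < α → 0 ≤ s₁ → s₁ ≤ r → 0 ≤ b → b ≤ ε / 2 →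
      5 * ((4 : ℕ) : ℝ) * L * inp.B₀ * (α + 11 * (4 : ℝ) ^ 2 * α) ≤ s₁ →
      5 * ((4 : ℕ) : ℝ) * L * inp.B₀ * (α + 11 * (4 : ℝ) ^ 2 * α) +
          2 * (b' + 226 * (8 * ((4 : ℝ) + 1) * ((4 : ℝ) + 4)) ^ 2 * b' ^ 2) * s₁ ≤ s₁ →
      5 * ((4 : ℕ) : ℝ) * L * inp.B₀ * (α + 11 * (4 : ℝ) ^ 2 * α) + 16 * (b' + 226 * (8 * ((4 : ℝ) + 1) * ((4 : ℝ) + 4)) ^ 2 * b' ^ 2) *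
          (5 * ((4 : ℕ) : ℝ) * L * inp.B₀ * (α + 11 * (4 : ℝ) ^ 2 * α)) ≤ s₁ →
      5 * ((4 : ℕ) : ℝ) * L * B₀β * (α + 11 * (4 : ℝ) ^ 2 * α) + 10 * (b' + 226 * (8 * ((4 : ℝ) + 1) * ((4 : ℝ) + 4)) ^ 2 * b' ^ 2) *
          (5 * ((4 : ℕ) : ℝ) * L * inp.B₀ * (α + 11 * (4 : ℝ) ^ 2 * α)) ≤ s₂ →
      ∀ {dom : _root_.Set (Site 4 → Fin 4 → (Matrix n n ℂ)ˣ)},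
        LeafH3sup 4 L N ε b' c' dom →
        CovRootHolderMS 4 (sfClass 4 L N ε) L N b g C s₁ s₂ β dom :=
  n16_holderMS_of_leafTP_l1Len (n := n) hL hN

/-! ## §2 Node N05's leaf-of-record SHAPE AT `zdGF3H` ⟹ N16's root (the ★s re-homed at the repaired family) -/

/-- ★ **N16 · NE3 (β = 1) FROM NODE N05's LEAF-OF-RECORD SHAPE ON `zdGF3H (M_n(ℂ)) L 1 len` OVER THE UNIV SUB-INDEX AND N07's (H3ˢᵘᵖ)** (`d = 4`, `L ≥ 2`, `N ≥ 1`) —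
generation 0's ★ `N16.OfLeafRS.n16_of_b8LeafRS` (vacuous at `zdGF3`, file 40 §1) RE-HOMED at n05-c's repaired family: ONE hypothesis `B8LeafRS 4 L C₂ B₁′ B₀′ B₁ B₂ c₁ inp B₀β
loc (fun i : {i : ZdIdx 4 L // i.Ω 0 = univ} ↦ zdGF3H (M_n ℂ) L 1 len i.1) lan cub toAxial` (only its `t4`, `p3` read; at `zdGF3H` the SHAPE is not known uninhabited), three
letter lines, then `∃ c₁′ > 0` with `16·(5·4·L·B₀)·c₁′ ≤ 1` and generation 0's file 5 §3 tail verbatim, ending in `LeafH3sup 4 L N ε b′ c′ dom → NE3EnergyRateWCov 4 (sfClass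
4 L N ε) L N b g C s₁ s₂ dom`.  §1 ∘ (`leaf.t4`, `leaf.p3`).  N16 ∕ NE3 NOT proved: the SHAPE is node N05's theorem-to-be, (H3ˢᵘᵖ) is N07's.
[cite: Balaban1985RegularSpaces, Lemma 1 – Thm 8 pp.79–101 (the leaf SHAPE), Thm 4 p.88, Prop. 3 p.87] [folklore] -/
theorem n16_of_b8LeafRSH [Nonempty n] {L N : ℕ} (hL : 2 ≤ L) (hN : 1 ≤ N) :
    letI : CStarAlgebra (Matrix n n ℂ) := {}
    ∃ r : ℝ, 0 < r ∧ ∀ ⦃g : ℝ⦄, 0 < g → ∃ C : ℝ, 0 ≤ C ∧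
      ∀ {I₁ I₃ I₄ : Type} (C₂ B₁' B₀' B₁ B₂ c₁ : ℝ) (inp : B8.B9Inputs) (B₀β : ℝ) (loc : I₁ → B8.LocalData)
        (lan : I₃ → B8.LandauData) (cub : I₄ → B8.CubeData) (len : Site 4 → ℝ)
        (toAxial : ∀ i : {i : ZdIdx 4 L // i.Ω 0 = Set.univ},
          (zdGF3H (Matrix n n ℂ) L 1 len i.1).Cfg → (zdGF3H (Matrix n n ℂ) L 1 len i.1).Pert → (zdGF3H (Matrix n n ℂ) L 1 len i.1).Pert),
      (∀ v : Site 4, 0 < len v → 1 ≤ len v) → (∀ μ : Fin 4, len (e μ) = 1) → 0 < B₁' → 5 * ((4 : ℕ) : ℝ) * L * inp.B₀ ≤ B₁' →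
      B8LeafRS 4 (L : ℝ) C₂ B₁' B₀' B₁ B₂ c₁ inp B₀β loc
        (fun i : {i : ZdIdx 4 L // i.Ω 0 = Set.univ} => zdGF3H (Matrix n n ℂ) L 1 len i.1) lan cub toAxial →
      ∃ c₁' : ℝ, 0 < c₁' ∧ 16 * (5 * ((4 : ℕ) : ℝ) * L * inp.B₀ * c₁') ≤ 1 ∧
      ∀ ⦃b' c' : ℝ⦄, 0 ≤ b' → 0 ≤ c' →
      2 ^ 15 * ((4 : ℝ) + 1) ^ 2 * ((4 : ℝ) + 4) ^ 2 * (L : ℝ) ^ 2 * b' ≤ 1 →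
      23040 * (4 : ℝ) ^ 4 * (frameC 4 L + 4) ^ 3 * (c' + curConst 4 L * b' ^ 2) ≤ 1 →
      ∀ ⦃α : ℝ⦄, 0 < α → C0 4 * α ≤ 1 / 3 → 2 * α ≤ c2' 4 L → 11 * (4 : ℝ) ^ 2 * α ≤ 1 / 6 → α + 11 * (4 : ℝ) ^ 2 * α ≤ c₁' →
      b' + 226 * (8 * ((4 : ℝ) + 1) * ((4 : ℝ) + 4)) ^ 2 * b' ^ 2 < α → 4 * ((4 : ℝ) - 1) * (c' + curConst 4 L * b' ^ 2) < α →
      ∀ ⦃Mc : ℝ⦄, 0 ≤ Mc → (Mc + 1) * (b' + 226 * (8 * ((4 : ℝ) + 1) * ((4 : ℝ) + 4)) ^ 2 * b' ^ 2) ≤ 1 / 2 →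
      ∀ (𝒬 : ℕ → Set (Set (Site 4) × ℕ)), (∀ k, ∀ q ∈ 𝒬 k, q.2 ≤ k ∧ ∃ y : Site 4, ∀ z ∈ q.1, (l1 (z - y) : ℝ) ≤ Mc * (L : ℝ) ^ q.2) →
      ∀ ⦃C335 : ℝ⦄, 2 * (Mc + 1) * (b' + 226 * (8 * ((4 : ℝ) + 1) * ((4 : ℝ) + 4)) ^ 2 * b' ^ 2) + 2 * Mc * (2 * (c' + curConst 4 L * b' ^ 2)) +
        4 * Mc * (1 + 2 * Mc) * (b' + 226 * (8 * ((4 : ℝ) + 1) * ((4 : ℝ) + 4)) ^ 2 * b' ^ 2) ^ 2 < C335 →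
      ∀ ⦃ε s₁ b s₂ : ℝ⦄, 0 < ε → ε ≤ r → ε < α → 0 ≤ s₁ → s₁ ≤ r → 0 ≤ b → b ≤ ε / 2 →
      5 * ((4 : ℕ) : ℝ) * L * inp.B₀ * (α + 11 * (4 : ℝ) ^ 2 * α) ≤ s₁ →
      5 * ((4 : ℕ) : ℝ) * L * inp.B₀ * (α + 11 * (4 : ℝ) ^ 2 * α) +
          2 * (b' + 226 * (8 * ((4 : ℝ) + 1) * ((4 : ℝ) + 4)) ^ 2 * b' ^ 2) * s₁ ≤ s₁ →
      5 * ((4 : ℕ) : ℝ) * L * inp.B₀ * (α + 11 * (4 : ℝ) ^ 2 * α) + 16 * (b' + 226 * (8 * ((4 : ℝ) + 1) * ((4 : ℝ) + 4)) ^ 2 * b' ^ 2) *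
          (5 * ((4 : ℕ) : ℝ) * L * inp.B₀ * (α + 11 * (4 : ℝ) ^ 2 * α)) ≤ s₁ →
      5 * ((4 : ℕ) : ℝ) * L * B₀β * (α + 11 * (4 : ℝ) ^ 2 * α) + 8 * (b' + 226 * (8 * ((4 : ℝ) + 1) * ((4 : ℝ) + 4)) ^ 2 * b' ^ 2) *
          (5 * ((4 : ℕ) : ℝ) * L * inp.B₀ * (α + 11 * (4 : ℝ) ^ 2 * α)) ≤ s₂ →
      ∀ {dom : _root_.Set (Site 4 → Fin 4 → (Matrix n n ℂ)ˣ)},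
        LeafH3sup 4 L N ε b' c' dom →
        NE3EnergyRateWCov 4 (sfClass 4 L N ε) L N b g C s₁ s₂ dom := by
  letI : CStarAlgebra (Matrix n n ℂ) := {}
  obtain ⟨r, hr0, hr⟩ := n16_of_leafTP (n := n) hL hN
  refine ⟨r, hr0, fun g hg => ?_⟩
  obtain ⟨C, hC0, hC⟩ := hr hg
  exact ⟨C, hC0, fun {I₁ I₃ I₄} C₂ B₁' B₀' B₁ B₂ c₁ inp B₀β loc lan cub len toAxial hlen hlen1 hB₁' hBB leaf =>
    hC C₂ B₁' inp B₀β len hlen hlen1 hB₁' hBB leaf.t4 leaf.p3⟩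

/-- ★ **N16 · THE MULTI-SCALE β-ROOT FROM NODE N05's LEAF-OF-RECORD SHAPE ON `zdGF3H (M_n(ℂ)) L β l1Len` OVER THE UNIV SUB-INDEX AND N07's (H3ˢᵘᵖ)** (`d = 4`,
`L ≥ 2`, `N ≥ 1`, ANY `β ∈ [0, 1]` — node N05's residual Hölder exponent; print's ℓ¹ length, both length letters discharged; repair R-β″) — generation 4's ★
`N16HolderMSOfLeafL1.n16_holderMS_of_b8LeafRS_l1Len` (vacuous at `zdGF3`) RE-HOMED at n05-c's repaired family: the SHAPE `B8LeafRS 4 L … (fun i ↦ zdGF3H (M_n ℂ) L β l1Len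
i.1) lan cub toAxial` + `0 < B₁′`, `5·4·L·B₀ ≤ B₁′` ⟹ `∃ c₁′ > 0` … generation 4's file 36 §2 tail verbatim, ending in `LeafH3sup 4 L N ε b′ c′ dom → CovRootHolderMS 4
(sfClass 4 L N ε) L N b g C s₁ s₂ β dom`.  §1 ∘ (`leaf.t4`, `leaf.p3`).  N16 ∕ NE3 NOT proved: the SHAPE is node N05's theorem-to-be, (H3ˢᵘᵖ) is N07's.
[cite: Balaban1985RegularSpaces, Lemma 1 – Thm 8 pp.79–101 (the leaf SHAPE), (1.36) p.82; Balaban1985BackgroundPropagators, (3.40) p.397] [folklore] -/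
theorem n16_holderMS_of_b8LeafRSH_l1Len [Nonempty n] {L N : ℕ} (hL : 2 ≤ L) (hN : 1 ≤ N) :
    letI : CStarAlgebra (Matrix n n ℂ) := {}
    ∃ r : ℝ, 0 < r ∧ ∀ ⦃g : ℝ⦄, 0 < g → ∃ C : ℝ, 0 ≤ C ∧
      ∀ {I₁ I₃ I₄ : Type} ⦃β : ℝ⦄, 0 ≤ β → β ≤ 1 → ∀ (C₂ B₁' B₀' B₁ B₂ c₁ : ℝ) (inp : B8.B9Inputs) (B₀β : ℝ) (loc : I₁ → B8.LocalData)
        (lan : I₃ → B8.LandauData) (cub : I₄ → B8.CubeData)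
        (toAxial : ∀ i : {i : ZdIdx 4 L // i.Ω 0 = Set.univ},
          (zdGF3H (Matrix n n ℂ) L β l1Len i.1).Cfg → (zdGF3H (Matrix n n ℂ) L β l1Len i.1).Pert → (zdGF3H (Matrix n n ℂ) L β l1Len i.1).Pert),
      0 < B₁' → 5 * ((4 : ℕ) : ℝ) * L * inp.B₀ ≤ B₁' →
      B8LeafRS 4 (L : ℝ) C₂ B₁' B₀' B₁ B₂ c₁ inp B₀β loc
        (fun i : {i : ZdIdx 4 L // i.Ω 0 = Set.univ} => zdGF3H (Matrix n n ℂ) L β l1Len i.1) lan cub toAxial →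
      ∃ c₁' : ℝ, 0 < c₁' ∧ 16 * (5 * ((4 : ℕ) : ℝ) * L * inp.B₀ * c₁') ≤ 1 ∧
      ∀ ⦃b' c' : ℝ⦄, 0 ≤ b' → 0 ≤ c' →
      2 ^ 15 * ((4 : ℝ) + 1) ^ 2 * ((4 : ℝ) + 4) ^ 2 * (L : ℝ) ^ 2 * b' ≤ 1 →
      23040 * (4 : ℝ) ^ 4 * (frameC 4 L + 4) ^ 3 * (c' + curConst 4 L * b' ^ 2) ≤ 1 →
      ∀ ⦃α : ℝ⦄, 0 < α → C0 4 * α ≤ 1 / 3 → 2 * α ≤ c2' 4 L → 11 * (4 : ℝ) ^ 2 * α ≤ 1 / 6 → α + 11 * (4 : ℝ) ^ 2 * α ≤ c₁' →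
      b' + 226 * (8 * ((4 : ℝ) + 1) * ((4 : ℝ) + 4)) ^ 2 * b' ^ 2 < α → 4 * ((4 : ℝ) - 1) * (c' + curConst 4 L * b' ^ 2) < α →
      ∀ ⦃Mc : ℝ⦄, 0 ≤ Mc → (Mc + 1) * (b' + 226 * (8 * ((4 : ℝ) + 1) * ((4 : ℝ) + 4)) ^ 2 * b' ^ 2) ≤ 1 / 2 →
      ∀ (𝒬 : ℕ → Set (Set (Site 4) × ℕ)), (∀ k, ∀ q ∈ 𝒬 k, q.2 ≤ k ∧ ∃ y : Site 4, ∀ z ∈ q.1, (l1 (z - y) : ℝ) ≤ Mc * (L : ℝ) ^ q.2) →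
      ∀ ⦃C335 : ℝ⦄, 2 * (Mc + 1) * (b' + 226 * (8 * ((4 : ℝ) + 1) * ((4 : ℝ) + 4)) ^ 2 * b' ^ 2) + 2 * Mc * (2 * (c' + curConst 4 L * b' ^ 2)) +
        4 * Mc * (1 + 2 * Mc) * (b' + 226 * (8 * ((4 : ℝ) + 1) * ((4 : ℝ) + 4)) ^ 2 * b' ^ 2) ^ 2 < C335 →
      ∀ ⦃ε s₁ b s₂ : ℝ⦄, 0 < ε → ε ≤ r → ε < α → 0 ≤ s₁ → s₁ ≤ r → 0 ≤ b → b ≤ ε / 2 →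
      5 * ((4 : ℕ) : ℝ) * L * inp.B₀ * (α + 11 * (4 : ℝ) ^ 2 * α) ≤ s₁ →
      5 * ((4 : ℕ) : ℝ) * L * inp.B₀ * (α + 11 * (4 : ℝ) ^ 2 * α) +
          2 * (b' + 226 * (8 * ((4 : ℝ) + 1) * ((4 : ℝ) + 4)) ^ 2 * b' ^ 2) * s₁ ≤ s₁ →
      5 * ((4 : ℕ) : ℝ) * L * inp.B₀ * (α + 11 * (4 : ℝ) ^ 2 * α) + 16 * (b' + 226 * (8 * ((4 : ℝ) + 1) * ((4 : ℝ) + 4)) ^ 2 * b' ^ 2) *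
          (5 * ((4 : ℕ) : ℝ) * L * inp.B₀ * (α + 11 * (4 : ℝ) ^ 2 * α)) ≤ s₁ →
      5 * ((4 : ℕ) : ℝ) * L * B₀β * (α + 11 * (4 : ℝ) ^ 2 * α) + 10 * (b' + 226 * (8 * ((4 : ℝ) + 1) * ((4 : ℝ) + 4)) ^ 2 * b' ^ 2) *
          (5 * ((4 : ℕ) : ℝ) * L * inp.B₀ * (α + 11 * (4 : ℝ) ^ 2 * α)) ≤ s₂ →
      ∀ {dom : _root_.Set (Site 4 → Fin 4 → (Matrix n n ℂ)ˣ)},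
        LeafH3sup 4 L N ε b' c' dom →
        CovRootHolderMS 4 (sfClass 4 L N ε) L N b g C s₁ s₂ β dom := by
  letI : CStarAlgebra (Matrix n n ℂ) := {}
  obtain ⟨r, hr0, hr⟩ := n16_holderMS_of_leafTP_l1Len (n := n) hL hN
  refine ⟨r, hr0, fun g hg => ?_⟩
  obtain ⟨C, hC0, hC⟩ := hr hg
  exact ⟨C, hC0, fun {I₁ I₃ I₄} β hβ0 hβ1 C₂ B₁' B₀' B₁ B₂ c₁ inp B₀β loc lan cub toAxial hB₁' hBB leaf =>
    hC hβ0 hβ1 C₂ B₁' inp B₀β hB₁' hBB leaf.t4 leaf.p3⟩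

/-- ★ **N16 · THE YM-PLAN ROW DECL `NE3Shape` FROM NODE N05's LEAF-OF-RECORD SHAPE ON `zdGF3H (M_n(ℂ)) L β len` OVER THE UNIV SUB-INDEX AND N07's (H3ˢᵘᵖ)** (`d = 4`,
`L ≥ 2`, `N ≥ 1`, ANY `β ∈ [0, 1]`) — generation 3's ★ `N16HolderShapeOfLeaf.ne3Shape_of_b8LeafRS_holder` (vacuous at `zdGF3`) RE-HOMED at n05-c's repaired family: the
SHAPE at `zdGF3H … L β len` + letters ⟹ `∃ c₁′ > 0` … file 19 §1's tail verbatim, ending in `dom ⊆ sfClass 4 L N ε₁ 0 → LeafH3sup 4 L N ε b c dom → (a regular minimising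
selection exists) ∧ ∀ sel, ∃ C′ ≥ 0, NE3Shape (minActReadings …) C′ (L⁻¹)`.  File 41's `ne3Shape_of_leafTP_holder` ∘ (`leaf.t4`, `leaf.p3`).  N16 ∕ NE3 NOT proved: the
SHAPE is node N05's theorem-to-be, (H3ˢᵘᵖ) is N07's. [cite: Balaban1985RegularSpaces, Lemma 1 – Thm 8 pp.79–101 (the leaf SHAPE), Thm 4 p.88, Prop. 3 p.87] [folklore] -/
theorem ne3Shape_of_b8LeafRSH_holder [Nonempty n] {L N : ℕ} (hL : 2 ≤ L) (hN : 1 ≤ N) :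
    letI : CStarAlgebra (Matrix n n ℂ) := {}
    ∃ r : ℝ, 0 < r ∧
      ∀ {I₁ I₃ I₄ : Type} ⦃β : ℝ⦄, 0 ≤ β → β ≤ 1 → ∀ (C₂ B₁' B₀' B₁ B₂ c₁ : ℝ) (inp : B8.B9Inputs) (B₀β : ℝ) (loc : I₁ → B8.LocalData)
        (lan : I₃ → B8.LandauData) (cub : I₄ → B8.CubeData) (len : Site 4 → ℝ)
        (toAxial : ∀ i : {i : ZdIdx 4 L // i.Ω 0 = Set.univ},
          (zdGF3H (Matrix n n ℂ) L β len i.1).Cfg → (zdGF3H (Matrix n n ℂ) L β len i.1).Pert → (zdGF3H (Matrix n n ℂ) L β len i.1).Pert),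
      (∀ v : Site 4, 0 < len v → 1 ≤ len v) → (∀ μ : Fin 4, len (e μ) = 1) → 0 < B₁' → 5 * ((4 : ℕ) : ℝ) * L * inp.B₀ ≤ B₁' →
      B8LeafRS 4 (L : ℝ) C₂ B₁' B₀' B₁ B₂ c₁ inp B₀β loc
        (fun i : {i : ZdIdx 4 L // i.Ω 0 = Set.univ} => zdGF3H (Matrix n n ℂ) L β len i.1) lan cub toAxial →
      ∃ c₁' : ℝ, 0 < c₁' ∧ 16 * (5 * ((4 : ℕ) : ℝ) * L * inp.B₀ * c₁') ≤ 1 ∧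
      ∀ ⦃ε s₁ t b c ε₁ : ℝ⦄, 0 < ε → ε ≤ r → 0 ≤ s₁ → s₁ ≤ r →
      0 ≤ b → b ≤ t → 0 < c → c ≤ t →
      (2 : ℝ) ^ 91 * (L : ℝ) ^ 17 * t ≤ 1 → (2 : ℝ) ^ 76 * (L : ℝ) ^ 12 * t ≤ ε →
      16 * C0 4 * ε ≤ 3 → 1024 * (4 + 1) * (4 + 4) * (L : ℝ) ^ 2 * ε ≤ 1 → b ≤ ε / 2 →
      23040 * (4 : ℝ) ^ 4 * (frameC 4 L + 4) ^ 3 * (c + curConst 4 L * b ^ 2) ≤ 1 →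
      ε₁ ≤ 1 / 4 → ε₁ ≤ b → 4 * ε₁ ≤ c →
      ∀ ⦃α : ℝ⦄, 0 < α → ε < α → C0 4 * α ≤ 1 / 3 → 2 * α ≤ c2' 4 L → 11 * (4 : ℝ) ^ 2 * α ≤ 1 / 6 → α + 11 * (4 : ℝ) ^ 2 * α ≤ c₁' →
      b + 226 * (8 * ((4 : ℝ) + 1) * ((4 : ℝ) + 4)) ^ 2 * b ^ 2 < α → 4 * ((4 : ℝ) - 1) * (c + curConst 4 L * b ^ 2) < α →
      ∀ ⦃Mc : ℝ⦄, 0 ≤ Mc → (Mc + 1) * (b + 226 * (8 * ((4 : ℝ) + 1) * ((4 : ℝ) + 4)) ^ 2 * b ^ 2) ≤ 1 / 2 →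
      ∀ (𝒬 : ℕ → Set (Set (Site 4) × ℕ)), (∀ k, ∀ q ∈ 𝒬 k, q.2 ≤ k ∧ ∃ y : Site 4, ∀ z ∈ q.1, (l1 (z - y) : ℝ) ≤ Mc * (L : ℝ) ^ q.2) →
      ∀ ⦃C335 : ℝ⦄, 2 * (Mc + 1) * (b + 226 * (8 * ((4 : ℝ) + 1) * ((4 : ℝ) + 4)) ^ 2 * b ^ 2) + 2 * Mc * (2 * (c + curConst 4 L * b ^ 2)) +
        4 * Mc * (1 + 2 * Mc) * (b + 226 * (8 * ((4 : ℝ) + 1) * ((4 : ℝ) + 4)) ^ 2 * b ^ 2) ^ 2 < C335 →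
      ∀ ⦃s₂ : ℝ⦄,
      5 * ((4 : ℕ) : ℝ) * L * inp.B₀ * (α + 11 * (4 : ℝ) ^ 2 * α) ≤ s₁ →
      5 * ((4 : ℕ) : ℝ) * L * inp.B₀ * (α + 11 * (4 : ℝ) ^ 2 * α) +
          2 * (b + 226 * (8 * ((4 : ℝ) + 1) * ((4 : ℝ) + 4)) ^ 2 * b ^ 2) * s₁ ≤ s₁ →
      5 * ((4 : ℕ) : ℝ) * L * inp.B₀ * (α + 11 * (4 : ℝ) ^ 2 * α) + 16 * (b + 226 * (8 * ((4 : ℝ) + 1) * ((4 : ℝ) + 4)) ^ 2 * b ^ 2) *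
          (5 * ((4 : ℕ) : ℝ) * L * inp.B₀ * (α + 11 * (4 : ℝ) ^ 2 * α)) ≤ s₁ →
      5 * ((4 : ℕ) : ℝ) * L * B₀β * (α + 11 * (4 : ℝ) ^ 2 * α) + 8 * (b + 226 * (8 * ((4 : ℝ) + 1) * ((4 : ℝ) + 4)) ^ 2 * b ^ 2) *
          (5 * ((4 : ℕ) : ℝ) * L * inp.B₀ * (α + 11 * (4 : ℝ) ^ 2 * α)) ≤ s₂ →
      ∀ {dom : _root_.Set (Site 4 → Fin 4 → (Matrix n n ℂ)ˣ)}, dom ⊆ sfClass 4 L N ε₁ 0 →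
        LeafH3sup 4 L N ε b c dom →
        (∃ sel : ℕ → (Site 4 → Fin 4 → (Matrix n n ℂ)ˣ) → (Site 4 → Fin 4 → (Matrix n n ℂ)ˣ),
            ∀ V ∈ dom, ∀ k : ℕ, IsMinimiser 4 (sfClass 4 L N ε) L N k V (sel k V) ∧ RegularSup 4 L N b c k (sel k V)) ∧
        ∀ sel : ℕ → (Site 4 → Fin 4 → (Matrix n n ℂ)ˣ) → (Site 4 → Fin 4 → (Matrix n n ℂ)ˣ),
          (∀ V ∈ dom, ∀ k : ℕ, IsMinimiser 4 (sfClass 4 L N ε) L N k V (sel k V)) →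
          (∀ V ∈ dom, ∀ k : ℕ, RegularSup 4 L N b c k (sel k V)) →
          ∃ C' : ℝ, 0 ≤ C' ∧
            NE3Shape
              (minActReadings 4 (sfClass 4 L N ε) L N dom
                (fun k V (x : ↥(periodBox (d := 4) N)) =>
                  fineAction (sel k V) (((blockSites L)^[k] {(x : Site 4)}) ×ˢ Finset.univ)))
              C' ((L : ℝ)⁻¹) := by
  letI : CStarAlgebra (Matrix n n ℂ) := {}
  obtain ⟨r, hr0, hr⟩ := ne3Shape_of_leafTP_holder (n := n) hL hN
  exact ⟨r, hr0, fun {I₁ I₃ I₄} β hβ0 hβ1 C₂ B₁' B₀' B₁ B₂ c₁ inp B₀β loc lan cub len toAxial hlen hlen1 hB₁' hBB leaf =>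
    hr hβ0 hβ1 C₂ B₁' inp B₀β len hlen hlen1 hB₁' hBB leaf.t4 leaf.p3⟩

end Matrices

/-! ## §3 n16-e's record slots `LeafSlot c` ∕ `LeafSlotHolderMS c β` from the SHAPE at `zdGF3H (M_N ℂ) c.L β len` -/

section Slot

variable {N : ℕ}

/-- **β = 1: FROM NODE N05's LEAF-OF-RECORD SHAPE AT `zdGF3H` TO n16-e's LEAF SLOT OF RECORD `LeafSlot c`** (`2 ≤ c.L`) — n16-e's `N16LeafSlotRS.leafSlot_of_b8LeafRS`
(vacuous at `zdGF3`) RE-HOMED at n05-c's repaired family: file 41's `N16OfLeafTPHolder.leafSlot_of_leafTP` ∘ (`leaf.t4`, `leaf.p3`) (definitional transfer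
`zdGF3H_toGFData(2)`).  [cite: Balaban1985RegularSpaces, Lemma 1 – Thm 8 pp.79–101 (the leaf SHAPE), Thm 4 p.88, Prop. 3 p.87] [folklore] -/
theorem leafSlot_of_b8LeafRSH [NeZero N] (c : NE3Carriers N) (hL : 2 ≤ c.L) {I₁ I₃ I₄ : Type} {C₂ B₁' B₀' B₁ B₂ c₁ : ℝ} {inp : B8.B9Inputs}
    {B₀β : ℝ} {loc : I₁ → B8.LocalData} {lan : I₃ → B8.LandauData} {cub : I₄ → B8.CubeData} {len : Site 4 → ℝ}
    {toAxial : letI : CStarAlgebra (Matrix (Fin N) (Fin N) ℂ) := {}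
      ∀ i : {i : ZdIdx 4 c.L // i.Ω 0 = Set.univ},
        (zdGF3H (Matrix (Fin N) (Fin N) ℂ) c.L 1 len i.1).Cfg → (zdGF3H (Matrix (Fin N) (Fin N) ℂ) c.L 1 len i.1).Pert →
          (zdGF3H (Matrix (Fin N) (Fin N) ℂ) c.L 1 len i.1).Pert}
    (hlen : ∀ v : Site 4, 0 < len v → 1 ≤ len v) (hlen1 : ∀ μ : Fin 4, len (e μ) = 1) (hB₁' : 0 < B₁')
    (hBB : 5 * ((4 : ℕ) : ℝ) * c.L * inp.B₀ ≤ B₁')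
    (leaf : letI : CStarAlgebra (Matrix (Fin N) (Fin N) ℂ) := {}
      B8LeafRS 4 (c.L : ℝ) C₂ B₁' B₀' B₁ B₂ c₁ inp B₀β loc
        (fun i : {i : ZdIdx 4 c.L // i.Ω 0 = Set.univ} => zdGF3H (Matrix (Fin N) (Fin N) ℂ) c.L 1 len i.1) lan cub toAxial) :
    ∃ c₁' : ℝ, 0 < c₁' ∧ 16 * (5 * ((4 : ℕ) : ℝ) * c.L * inp.B₀ * c₁') ≤ 1 ∧
      ∀ ⦃b' c' : ℝ⦄, 0 ≤ b' → 0 ≤ c' →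
      2 ^ 15 * ((4 : ℝ) + 1) ^ 2 * ((4 : ℝ) + 4) ^ 2 * (c.L : ℝ) ^ 2 * b' ≤ 1 →
      23040 * (4 : ℝ) ^ 4 * (frameC 4 c.L + 4) ^ 3 * (c' + curConst 4 c.L * b' ^ 2) ≤ 1 →
      ∀ ⦃α : ℝ⦄, 0 < α → C0 4 * α ≤ 1 / 3 → 2 * α ≤ c2' 4 c.L → 11 * (4 : ℝ) ^ 2 * α ≤ 1 / 6 → α + 11 * (4 : ℝ) ^ 2 * α ≤ c₁' →
      b' + 226 * (8 * ((4 : ℝ) + 1) * ((4 : ℝ) + 4)) ^ 2 * b' ^ 2 < α → 4 * ((4 : ℝ) - 1) * (c' + curConst 4 c.L * b' ^ 2) < α →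
      ∀ ⦃Mc : ℝ⦄, 0 ≤ Mc → (Mc + 1) * (b' + 226 * (8 * ((4 : ℝ) + 1) * ((4 : ℝ) + 4)) ^ 2 * b' ^ 2) ≤ 1 / 2 →
      ∀ (𝒬 : ℕ → Set (Set (Site 4) × ℕ)), (∀ k, ∀ q ∈ 𝒬 k, q.2 ≤ k ∧ ∃ y : Site 4, ∀ z ∈ q.1, (l1 (z - y) : ℝ) ≤ Mc * (c.L : ℝ) ^ q.2) →
      ∀ ⦃C335 : ℝ⦄, 2 * (Mc + 1) * (b' + 226 * (8 * ((4 : ℝ) + 1) * ((4 : ℝ) + 4)) ^ 2 * b' ^ 2) + 2 * Mc * (2 * (c' + curConst 4 c.L * b' ^ 2)) +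
        4 * Mc * (1 + 2 * Mc) * (b' + 226 * (8 * ((4 : ℝ) + 1) * ((4 : ℝ) + 4)) ^ 2 * b' ^ 2) ^ 2 < C335 →
      c.ε < α → 5 * ((4 : ℕ) : ℝ) * c.L * inp.B₀ * (α + 11 * (4 : ℝ) ^ 2 * α) ≤ c.Λ₁ →
      5 * ((4 : ℕ) : ℝ) * c.L * inp.B₀ * (α + 11 * (4 : ℝ) ^ 2 * α) +
          2 * (b' + 226 * (8 * ((4 : ℝ) + 1) * ((4 : ℝ) + 4)) ^ 2 * b' ^ 2) * c.Λ₁ ≤ c.Λ₁ →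
      5 * ((4 : ℕ) : ℝ) * c.L * inp.B₀ * (α + 11 * (4 : ℝ) ^ 2 * α) + 16 * (b' + 226 * (8 * ((4 : ℝ) + 1) * ((4 : ℝ) + 4)) ^ 2 * b' ^ 2) *
          (5 * ((4 : ℕ) : ℝ) * c.L * inp.B₀ * (α + 11 * (4 : ℝ) ^ 2 * α)) ≤ c.Λ₁ →
      5 * ((4 : ℕ) : ℝ) * c.L * B₀β * (α + 11 * (4 : ℝ) ^ 2 * α) + 8 * (b' + 226 * (8 * ((4 : ℝ) + 1) * ((4 : ℝ) + 4)) ^ 2 * b' ^ 2) *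
          (5 * ((4 : ℕ) : ℝ) * c.L * inp.B₀ * (α + 11 * (4 : ℝ) ^ 2 * α)) ≤ c.Λ₂' →
      LeafH3sup 4 c.L c.Nper c.ε b' c' c.dom → LeafSlot c :=
  leafSlot_of_leafTP c hL hlen hlen1 hB₁' hBB leaf.t4 leaf.p3

/-- **FROM NODE N05's LEAF-OF-RECORD SHAPE AT `zdGF3H` TO n16-e's MS LEAF β-SLOT `LeafSlotHolderMS c β`** (`2 ≤ c.L`; any `β`; length letter `len (j•e_μ) = j`) —
n16-e's `N16HolderMSLeafSlot.leafSlotHolderMS_of_b8LeafRS` (vacuous at `zdGF3`; the ENTRY of n16-e's MS record kit) RE-HOMED at n05-c's repaired family: file 41's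
`N16OfLeafTPHolder.leafSlotHolderMS_of_leafTP` ∘ (`leaf.t4`, `leaf.p3`) (definitional transfer `zdGF3H_toGFData(2)`).
[cite: Balaban1985RegularSpaces, Lemma 1 – Thm 8 pp.79–101 (the leaf SHAPE), Thm 4 p.88, Prop. 3 p.87, (1.36) p.82] [folklore] -/
theorem leafSlotHolderMS_of_b8LeafRSH [NeZero N] (c : NE3Carriers N) (hL : 2 ≤ c.L) {β : ℝ} {I₁ I₃ I₄ : Type} {C₂ B₁' B₀' B₁ B₂ c₁ : ℝ}
    {inp : B8.B9Inputs} {B₀β : ℝ} {loc : I₁ → B8.LocalData} {lan : I₃ → B8.LandauData} {cub : I₄ → B8.CubeData} {len : Site 4 → ℝ}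
    {toAxial : letI : CStarAlgebra (Matrix (Fin N) (Fin N) ℂ) := {}
      ∀ i : {i : ZdIdx 4 c.L // i.Ω 0 = Set.univ},
        (zdGF3H (Matrix (Fin N) (Fin N) ℂ) c.L β len i.1).Cfg → (zdGF3H (Matrix (Fin N) (Fin N) ℂ) c.L β len i.1).Pert →
          (zdGF3H (Matrix (Fin N) (Fin N) ℂ) c.L β len i.1).Pert}
    (hlen : ∀ v : Site 4, 0 < len v → 1 ≤ len v) (hlenj : ∀ (μ : Fin 4) (j : ℕ), len (j • e μ) = j) (hB₁' : 0 < B₁')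
    (hBB : 5 * ((4 : ℕ) : ℝ) * c.L * inp.B₀ ≤ B₁')
    (leaf : letI : CStarAlgebra (Matrix (Fin N) (Fin N) ℂ) := {}
      B8LeafRS 4 (c.L : ℝ) C₂ B₁' B₀' B₁ B₂ c₁ inp B₀β loc
        (fun i : {i : ZdIdx 4 c.L // i.Ω 0 = Set.univ} => zdGF3H (Matrix (Fin N) (Fin N) ℂ) c.L β len i.1) lan cub toAxial) :
    ∃ c₁' : ℝ, 0 < c₁' ∧ 16 * (5 * ((4 : ℕ) : ℝ) * c.L * inp.B₀ * c₁') ≤ 1 ∧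
      ∀ ⦃b' c' : ℝ⦄, 0 ≤ b' → 0 ≤ c' →
      2 ^ 15 * ((4 : ℝ) + 1) ^ 2 * ((4 : ℝ) + 4) ^ 2 * (c.L : ℝ) ^ 2 * b' ≤ 1 →
      23040 * (4 : ℝ) ^ 4 * (frameC 4 c.L + 4) ^ 3 * (c' + curConst 4 c.L * b' ^ 2) ≤ 1 →
      ∀ ⦃α : ℝ⦄, 0 < α → C0 4 * α ≤ 1 / 3 → 2 * α ≤ c2' 4 c.L → 11 * (4 : ℝ) ^ 2 * α ≤ 1 / 6 → α + 11 * (4 : ℝ) ^ 2 * α ≤ c₁' →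
      b' + 226 * (8 * ((4 : ℝ) + 1) * ((4 : ℝ) + 4)) ^ 2 * b' ^ 2 < α → 4 * ((4 : ℝ) - 1) * (c' + curConst 4 c.L * b' ^ 2) < α →
      ∀ ⦃Mc : ℝ⦄, 0 ≤ Mc → (Mc + 1) * (b' + 226 * (8 * ((4 : ℝ) + 1) * ((4 : ℝ) + 4)) ^ 2 * b' ^ 2) ≤ 1 / 2 →
      ∀ (𝒬 : ℕ → Set (Set (Site 4) × ℕ)), (∀ k, ∀ q ∈ 𝒬 k, q.2 ≤ k ∧ ∃ y : Site 4, ∀ z ∈ q.1, (l1 (z - y) : ℝ) ≤ Mc * (c.L : ℝ) ^ q.2) →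
      ∀ ⦃C335 : ℝ⦄, 2 * (Mc + 1) * (b' + 226 * (8 * ((4 : ℝ) + 1) * ((4 : ℝ) + 4)) ^ 2 * b' ^ 2) + 2 * Mc * (2 * (c' + curConst 4 c.L * b' ^ 2)) +
        4 * Mc * (1 + 2 * Mc) * (b' + 226 * (8 * ((4 : ℝ) + 1) * ((4 : ℝ) + 4)) ^ 2 * b' ^ 2) ^ 2 < C335 →
      c.ε < α → 5 * ((4 : ℕ) : ℝ) * c.L * inp.B₀ * (α + 11 * (4 : ℝ) ^ 2 * α) ≤ c.Λ₁ →
      5 * ((4 : ℕ) : ℝ) * c.L * inp.B₀ * (α + 11 * (4 : ℝ) ^ 2 * α) +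
          2 * (b' + 226 * (8 * ((4 : ℝ) + 1) * ((4 : ℝ) + 4)) ^ 2 * b' ^ 2) * c.Λ₁ ≤ c.Λ₁ →
      5 * ((4 : ℕ) : ℝ) * c.L * inp.B₀ * (α + 11 * (4 : ℝ) ^ 2 * α) + 16 * (b' + 226 * (8 * ((4 : ℝ) + 1) * ((4 : ℝ) + 4)) ^ 2 * b' ^ 2) *
          (5 * ((4 : ℕ) : ℝ) * c.L * inp.B₀ * (α + 11 * (4 : ℝ) ^ 2 * α)) ≤ c.Λ₁ →
      5 * ((4 : ℕ) : ℝ) * c.L * B₀β * (α + 11 * (4 : ℝ) ^ 2 * α) + 10 * (b' + 226 * (8 * ((4 : ℝ) + 1) * ((4 : ℝ) + 4)) ^ 2 * b' ^ 2) *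
          (5 * ((4 : ℕ) : ℝ) * c.L * inp.B₀ * (α + 11 * (4 : ℝ) ^ 2 * α)) ≤ c.Λ₂' →
      LeafH3sup 4 c.L c.Nper c.ε b' c' c.dom → LeafSlotHolderMS c β :=
  leafSlotHolderMS_of_leafTP c hL hlen hlenj hB₁' hBB leaf.t4 leaf.p3

end Slot

end

end Summit.QuantumFields.YangMills.BalabanUVNodes.N16OfLeafH
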